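import Summits.QuantumFields.YangMills.Theorems.VirialFluxGapSharpTwistedLaplaceQuantitativeLaplaceGauss
import Summits.QuantumFields.YangMills.Theorems.VirialFluxGapSharpTwistedLaplaceDetBounds
import HarnessLib

/-!
# The one-sided GAUSSIAN CEILING of a Laplace integral from a quadratic floor with a `(1 − δ)`-sharp form — the crude-tip tool
# (LEAD ym-line-sfw-p2 g97's steep-window plan, brick W6 (T1); free-hands support of ⟨stmt-QuantumFields-24197⟩ `SwapVirialDeficit.SwapGluedStiffness`; generic)

At a TIP base point the steep-window plan (HOME `sfw-p2-g97-memo-24197-steep-window-morse-bott.md` §1 (B-tip) (T1)) needs no two-sided Laplace asymptotic, only an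
UPPER bound with the SHARP Gaussian constant up to a bounded factor and NO per-mode loss in the `m = 3|Fol L|` follower directions: from a quadratic floor
`F(y) ≥ F₀ + ½(1 − δ)⟪Ay, y⟫` on the integration set (`0 ≤ δ < 1`; e.g. `δ = 1/(2m)` from a cubic Taylor bound on a sup-box) one gets
`∫_S e^{−βF} w ≤ W₀ · e^{−βF₀} · (2π/((1−δ)β))^{m/2}/√det A`, and `(1 − δ)^{−m/2} ≤ e^{1/2}`-type factors are harmless.  This file:
* ★★ `setIntegral_exp_neg_mul_le_gaussian_of_floor` — the ceiling, for any measurable `S`, measurable `F` with the floor on `S`, measurable `0 ≤ w ≤ W₀` on `S`;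
* ★ `rpow_div_one_sub_le` — `(1/(1 − δ))^{m/2} ≤ exp(m·δ/(2(1−δ)))`, so `δ = 1/(2m)` (`m ≥ 1`) costs at most the factor `e^{1/2}`;
* ★ `setIntegral_exp_neg_mul_le_gaussian_of_floor_half` — the two combined at `δ ≤ 1/(2m)`: ceiling `W₀ e^{1/2} e^{−βF₀} (2π/β)^{m/2}/√det A`.
Companions: ✓`integral_exp_neg_mul_half_inner` (the scaled Gaussian), ✓`abs_log_det_sub_log_det_le` ((T2): comparing `det A` between neighbouring fibres),
✓`laplaceMethod_quantitative_skewProduct_of_taylor` (the two-sided bulk).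

HONEST FRAMING: elementary real analysis; width 0 by itself toward any lattice statement; ⟨24197⟩, ⟨24196⟩, ⟨24194⟩, ⟨24497⟩ and every rung ∕ summit statement stay OPEN;
own crux ⟨22884⟩ OPEN (blocked-on ⟨19935⟩); the Yang–Mills mass gap is NOT proved; no summit is proved by a line.  Width seat ym-line-sfw-p2-w2 g58 (cell ym-idea-1,
free hands), `--supports stmt-QuantumFields-24197`.  THEOREMS ONLY (0 `def`, 0 `sorry`), standard axioms.

## References
* K. W. Breitung, *Asymptotic Approximations for Probability Integrals*, LNM 1592 (1994), Lemma 26 (2.102) p. 30, Lemma 39 p. 55. [Breitung1994]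
-/

set_option autoImplicit false

noncomputable section

open _root_.MeasureTheory _root_.Set _root_.Module _root_.Metric
open scoped _root_.Real _root_.InnerProductSpace

namespace Summit.QuantumFields.YangMills.Theorems.QuantitativeLaplace

variable {V : Type*} [NormedAddCommGroup V] [InnerProductSpace ℝ V] [FiniteDimensional ℝ V]
  [MeasurableSpace V] [BorelSpace V]

/-- ★★ **Gaussian ceiling from a quadratic floor.**  `A` symmetric and `λ`-coercive (`λ > 0`) on the `m`-dimensional `V`, `δ < 1`, `β > 0`;
`S` measurable; `F`, `w` measurable with `F y ≥ F₀ + ½(1−δ)⟪A y, y⟫` and `0 ≤ w y ≤ W₀` for `y ∈ S`.  Then `e^{−βF}w` is integrable on `S` and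
`∫_S e^{−βF} w ≤ W₀ · e^{−βF₀} · (2π/((1−δ)β))^{m/2}/√det A`. [cite: Breitung1994, Lemma 26 (2.102) p. 30] -/
theorem setIntegral_exp_neg_mul_le_gaussian_of_floor {A : V →ₗ[ℝ] V} (hA : A.IsSymmetric) {lam : ℝ} (hlam : 0 < lam)
    (hcoer : ∀ y : V, lam * ‖y‖ ^ 2 ≤ ⟪A y, y⟫_ℝ)
    {δ β F₀ W₀ : ℝ} (hδ1 : δ < 1) (hβ : 0 < β) (hW₀ : 0 ≤ W₀)
    {S : Set V} (hS : MeasurableSet S) {F w : V → ℝ} (hFm : Measurable F) (hwm : Measurable w)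
    (hfloor : ∀ y ∈ S, F₀ + (1 / 2) * (1 - δ) * ⟪A y, y⟫_ℝ ≤ F y)
    (hw0 : ∀ y ∈ S, 0 ≤ w y) (hwW : ∀ y ∈ S, w y ≤ W₀) :
    IntegrableOn (fun y => Real.exp (-(β * F y)) * w y) S ∧
    ∫ y in S, Real.exp (-(β * F y)) * w y ≤
      W₀ * Real.exp (-(β * F₀)) * ((2 * π / ((1 - δ) * β)) ^ ((finrank ℝ V : ℝ) / 2) / Real.sqrt (LinearMap.det A)) := by
  have hs : 0 < (1 - δ) * β := mul_pos (by linarith) hβ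
  -- the dominating Gaussian `g y = W₀ e^{−βF₀} e^{−(1−δ)β·½⟪Ay,y⟫}`
  set g : V → ℝ := fun y => W₀ * Real.exp (-(β * F₀)) * Real.exp (-(((1 - δ) * β) * ((1 / 2) * ⟪A y, y⟫_ℝ))) with hgdef
  have hgint : Integrable g := (integrable_exp_neg_mul_half_inner hlam hcoer hs).const_mul _
  have hgval : ∫ y, g y = W₀ * Real.exp (-(β * F₀)) * ((2 * π / ((1 - δ) * β)) ^ ((finrank ℝ V : ℝ) / 2) / Real.sqrt (LinearMap.det A)) := by
    simp only [hgdef]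
    rw [integral_const_mul, integral_exp_neg_mul_half_inner hA hlam hcoer hs]
  -- pointwise domination on `S`
  have hFwm : Measurable fun y => Real.exp (-(β * F y)) * w y := ((hFm.const_mul β).neg.exp).mul hwm
  have hdom : ∀ y ∈ S, |Real.exp (-(β * F y)) * w y| ≤ g y := by
    intro y hy
    rw [abs_mul, abs_of_pos (Real.exp_pos _), abs_of_nonneg (hw0 y hy), hgdef]
    have h1 : Real.exp (-(β * F y)) ≤ Real.exp (-(β * F₀)) * Real.exp (-(((1 - δ) * β) * ((1 / 2) * ⟪A y, y⟫_ℝ))) := by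
      rw [← Real.exp_add, Real.exp_le_exp]
      have := hfloor y hy
      nlinarith
    calc Real.exp (-(β * F y)) * w y ≤ (Real.exp (-(β * F₀)) * Real.exp (-(((1 - δ) * β) * ((1 / 2) * ⟪A y, y⟫_ℝ)))) * W₀ :=
        mul_le_mul h1 (hwW y hy) (hw0 y hy) (by positivity)
      _ = W₀ * Real.exp (-(β * F₀)) * Real.exp (-(((1 - δ) * β) * ((1 / 2) * ⟪A y, y⟫_ℝ))) := by ring
  have hint : IntegrableOn (fun y => Real.exp (-(β * F y)) * w y) S := by
    refine Integrable.mono' hgint.integrableOn hFwm.aestronglyMeasurable ?_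
    exact (ae_restrict_iff' hS).2 (Filter.Eventually.of_forall fun y hy => by rw [Real.norm_eq_abs]; exact hdom y hy)
  refine ⟨hint, ?_⟩
  have hg0 : ∀ y, 0 ≤ g y := fun y => by simp only [hgdef]; positivity
  calc ∫ y in S, Real.exp (-(β * F y)) * w y ≤ ∫ y in S, g y :=
        setIntegral_mono_on hint hgint.integrableOn hS fun y hy => (le_abs_self _).trans (hdom y hy)
    _ ≤ ∫ y, g y := setIntegral_le_integral hgint (Filter.Eventually.of_forall hg0)
    _ = _ := hgval

/-- ★ **The `(1−δ)`-sharp form costs a bounded factor**: for `δ < 1`, `0 ≤ m`, `(1/(1−δ))^{m/2} ≤ exp(m·δ/(2(1−δ)))` (from `log(1/(1−δ)) ≤ δ/(1−δ)`);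
in particular `δ ≤ 1/(2m)` gives at most `e^{1/2}`. [folklore] -/
theorem rpow_div_one_sub_le {δ m : ℝ} (hδ1 : δ < 1) (hm : 0 ≤ m) :
    (1 / (1 - δ)) ^ (m / 2) ≤ Real.exp (m * δ / (2 * (1 - δ))) := by
  have h1 : 0 < 1 - δ := by linarith
  have hlog : Real.log (1 / (1 - δ)) ≤ δ / (1 - δ) := by
    rw [one_div, Real.log_inv]
    have h := Real.one_sub_inv_le_log_of_pos h1
    have e : 1 - (1 - δ)⁻¹ = -(δ / (1 - δ)) := by field_simp; ring
    rw [e] at h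
    linarith
  rw [Real.rpow_def_of_pos (by positivity), Real.exp_le_exp]
  have : Real.log (1 / (1 - δ)) * (m / 2) ≤ δ / (1 - δ) * (m / 2) := mul_le_mul_of_nonneg_right hlog (by positivity)
  calc Real.log (1 / (1 - δ)) * (m / 2) ≤ δ / (1 - δ) * (m / 2) := this
    _ = m * δ / (2 * (1 - δ)) := by field_simp

/-- ★ **The ceiling with a `(1 − 1/(2m))`-sharp form**: if `δ·2m ≤ 1` and `δ ≤ 1/2` (`m = finrank V`), then
`∫_S e^{−βF} w ≤ W₀ · e^{1/2} · e^{−βF₀} · (2π/β)^{m/2}/√det A` — the sharp Gaussian constant up to the factor `e^{1/2}`, no per-mode loss.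
[cite: Breitung1994, Lemma 26 (2.102) p. 30] -/
theorem setIntegral_exp_neg_mul_le_gaussian_of_floor_half {A : V →ₗ[ℝ] V} (hA : A.IsSymmetric) {lam : ℝ} (hlam : 0 < lam)
    (hcoer : ∀ y : V, lam * ‖y‖ ^ 2 ≤ ⟪A y, y⟫_ℝ)
    {δ β F₀ W₀ : ℝ} (hδm : δ * (2 * (finrank ℝ V : ℝ)) ≤ 1) (hδhalf : δ ≤ 1 / 2) (hβ : 0 < β) (hW₀ : 0 ≤ W₀)
    {S : Set V} (hS : MeasurableSet S) {F w : V → ℝ} (hFm : Measurable F) (hwm : Measurable w)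
    (hfloor : ∀ y ∈ S, F₀ + (1 / 2) * (1 - δ) * ⟪A y, y⟫_ℝ ≤ F y)
    (hw0 : ∀ y ∈ S, 0 ≤ w y) (hwW : ∀ y ∈ S, w y ≤ W₀) :
    ∫ y in S, Real.exp (-(β * F y)) * w y ≤
      W₀ * Real.exp (1 / 2) * Real.exp (-(β * F₀)) * ((2 * π / β) ^ ((finrank ℝ V : ℝ) / 2) / Real.sqrt (LinearMap.det A)) := by
  set m : ℝ := (finrank ℝ V : ℝ) with hm
  have hm0 : 0 ≤ m := Nat.cast_nonneg _
  have hδ1 : δ < 1 := by linarith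
  have h1δ : 0 < 1 - δ := by linarith
  obtain ⟨-, hbd⟩ := setIntegral_exp_neg_mul_le_gaussian_of_floor hA hlam hcoer hδ1 hβ hW₀ hS hFm hwm hfloor hw0 hwW
  -- split the scaled Gaussian constant: `(2π/((1−δ)β))^{m/2} = (1/(1−δ))^{m/2} · (2π/β)^{m/2}`
  have hsplit : (2 * π / ((1 - δ) * β)) ^ (m / 2) = (1 / (1 - δ)) ^ (m / 2) * (2 * π / β) ^ (m / 2) := by
    rw [← Real.mul_rpow (by positivity) (by positivity)]
    congr 1
    field_simp
  -- the factor `(1/(1−δ))^{m/2} ≤ exp(mδ/(2(1−δ))) ≤ exp(1/2)`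
  have hfac : (1 / (1 - δ)) ^ (m / 2) ≤ Real.exp (1 / 2) := by
    refine (rpow_div_one_sub_le hδ1 hm0).trans ?_
    rw [Real.exp_le_exp, div_le_iff₀ (by positivity)]
    -- `m δ ≤ 1/2` and `1 − δ ≥ 1/2`
    nlinarith
  have hdet : 0 < Real.sqrt (LinearMap.det A) :=
    Real.sqrt_pos.2 (lt_of_lt_of_le (pow_pos hlam _) (pow_le_det_of_coercive hA hlam.le hcoer))
  have hG0 : 0 ≤ (2 * π / β) ^ (m / 2) / Real.sqrt (LinearMap.det A) := by positivity
  rw [hsplit, mul_div_assoc] at hbd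
  calc ∫ y in S, Real.exp (-(β * F y)) * w y
      ≤ W₀ * Real.exp (-(β * F₀)) * ((1 / (1 - δ)) ^ (m / 2) * ((2 * π / β) ^ (m / 2) / Real.sqrt (LinearMap.det A))) := hbd
    _ ≤ W₀ * Real.exp (-(β * F₀)) * (Real.exp (1 / 2) * ((2 * π / β) ^ (m / 2) / Real.sqrt (LinearMap.det A))) := by
        gcongr
    _ = W₀ * Real.exp (1 / 2) * Real.exp (-(β * F₀)) * ((2 * π / β) ^ (m / 2) / Real.sqrt (LinearMap.det A)) := by ring

/-! ### (appended 2026-08-31, same seat) The ceiling with the quadratic floor CENTRED AT A FIBRE MINIMISER `c`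

The tip step (T1) of the LEAD g97 plan reads the floor around the follower minimiser `y⋆ ≠ 0`: `F y ≥ m + ½(1 − δ)⟨A_F(y − y⋆), y − y⋆⟩` on a box (✓`form_floor_of_third_directional`);
translation invariance of Lebesgue measure reduces it to the centred case above. -/

/-- ★★ **GAUSSIAN CEILING from a quadratic floor centred at `c`.**  Same as ✓`setIntegral_exp_neg_mul_le_gaussian_of_floor` with the floor
`F₀ + ½(1 − δ)⟪A(y − c), y − c⟫ ≤ F y` on `S`: `∫_S e^{−βF} w ≤ W₀·e^{−βF₀}·(2π∕((1−δ)β))^{m∕2}∕√det A` (translate by `c`; Lebesgue measure is invariant). [folklore] -/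
theorem setIntegral_exp_neg_mul_le_gaussian_of_floor_centre {A : V →ₗ[ℝ] V} (hA : A.IsSymmetric) {lam : ℝ} (hlam : 0 < lam)
    (hcoer : ∀ y : V, lam * ‖y‖ ^ 2 ≤ ⟪A y, y⟫_ℝ)
    {δ β F₀ W₀ : ℝ} (hδ1 : δ < 1) (hβ : 0 < β) (hW₀ : 0 ≤ W₀)
    {S : Set V} (hS : MeasurableSet S) {F w : V → ℝ} (hFm : Measurable F) (hwm : Measurable w) (c : V)
    (hfloor : ∀ y ∈ S, F₀ + (1 / 2) * (1 - δ) * ⟪A (y - c), y - c⟫_ℝ ≤ F y)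
    (hw0 : ∀ y ∈ S, 0 ≤ w y) (hwW : ∀ y ∈ S, w y ≤ W₀) :
    ∫ y in S, Real.exp (-(β * F y)) * w y ≤
      W₀ * Real.exp (-(β * F₀)) * ((2 * π / ((1 - δ) * β)) ^ ((finrank ℝ V : ℝ) / 2) / Real.sqrt (LinearMap.det A)) := by
  -- translated data
  set F' : V → ℝ := fun y => F (y + c) with hF'
  set w' : V → ℝ := fun y => w (y + c) with hw'
  set S' : Set V := (fun y => y + c) ⁻¹' S with hS'
  have hτ : Measurable fun y : V => y + c := measurable_id.add_const c
  have hS'm : MeasurableSet S' := hS.preimage hτ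
  have hF'm : Measurable F' := hFm.comp hτ
  have hw'm : Measurable w' := hwm.comp hτ
  have hfloor' : ∀ y ∈ S', F₀ + (1 / 2) * (1 - δ) * ⟪A y, y⟫_ℝ ≤ F' y := fun y hy => by
    have h := hfloor (y + c) hy
    simpa only [hF', add_sub_cancel_right] using h
  obtain ⟨-, hbd⟩ := setIntegral_exp_neg_mul_le_gaussian_of_floor hA hlam hcoer hδ1 hβ hW₀ hS'm hF'm hw'm hfloor'
    (fun y hy => hw0 _ hy) (fun y hy => hwW _ hy)
  -- the two integrals agree by translation invariance of Lebesgue measure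
  have heq : ∫ y in S, Real.exp (-(β * F y)) * w y = ∫ y in S', Real.exp (-(β * F' y)) * w' y := by
    rw [← integral_indicator hS, ← integral_indicator hS'm]
    have h1 : (fun y => S'.indicator (fun y => Real.exp (-(β * F' y)) * w' y) y) =
        fun y => S.indicator (fun y => Real.exp (-(β * F y)) * w y) (y + c) := by
      funext y
      exact (Set.indicator_comp_right (f := fun y : V => y + c) (g := fun y => Real.exp (-(β * F y)) * w y) (s := S) (x := y))
    rw [h1]
    exact (integral_add_right_eq_self (S.indicator fun y => Real.exp (-(β * F y)) * w y) c).symm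
  rw [heq]
  exact hbd

/-- ★★★ **(T1) by name — GAUSSIAN CEILING ON THE BOX PLUS A FLAT TAIL OFF THE BOX.**  On a measurable `S` split by a measurable box `B`: the centred floor
`F₀ + ½(1 − δ)⟪A(y − c), y − c⟫ ≤ F y` on `S ∩ B`, a flat floor `F₁ ≤ F y` on `S \ B`, and a weight `0 ≤ w ≤ W₀` integrable on `S` give
`∫_S e^{−βF} w ≤ W₀·e^{−βF₀}·(2π∕((1−δ)β))^{m∕2}∕√det A + e^{−βF₁}·∫_S w` — the LEAD plan's
`J_F(P̃) ≤ w_{F,0}·e^{−b m(P̃)}·(2π/((1−δ)b))^{3|Fol|/2}·det A_F(P̃)^{−1/2} + e^{−bF̂_max}·(mass)`. [folklore] -/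
theorem setIntegral_exp_neg_mul_le_gaussian_add_tail {A : V →ₗ[ℝ] V} (hA : A.IsSymmetric) {lam : ℝ} (hlam : 0 < lam)
    (hcoer : ∀ y : V, lam * ‖y‖ ^ 2 ≤ ⟪A y, y⟫_ℝ)
    {δ β F₀ F₁ W₀ : ℝ} (hδ1 : δ < 1) (hβ : 0 < β) (hW₀ : 0 ≤ W₀)
    {S B : Set V} (hS : MeasurableSet S) (hB : MeasurableSet B) {F w : V → ℝ} (hFm : Measurable F) (hwm : Measurable w) (c : V)
    (hfloor : ∀ y ∈ S ∩ B, F₀ + (1 / 2) * (1 - δ) * ⟪A (y - c), y - c⟫_ℝ ≤ F y)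
    (hfar : ∀ y ∈ S \ B, F₁ ≤ F y)
    (hw0 : ∀ y ∈ S, 0 ≤ w y) (hwW : ∀ y ∈ S, w y ≤ W₀) (hwi : IntegrableOn w S) :
    IntegrableOn (fun y => Real.exp (-(β * F y)) * w y) S ∧
    ∫ y in S, Real.exp (-(β * F y)) * w y ≤
      W₀ * Real.exp (-(β * F₀)) * ((2 * π / ((1 - δ) * β)) ^ ((finrank ℝ V : ℝ) / 2) / Real.sqrt (LinearMap.det A)) +
        Real.exp (-(β * F₁)) * ∫ y in S, w y := by
  have h1δ : 0 < 1 - δ := by linarith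
  -- a uniform lower bound of `F` on `S`: `min F₀ F₁`
  have hFlow : ∀ y ∈ S, min F₀ F₁ ≤ F y := by
    intro y hy
    by_cases hyB : y ∈ B
    · have hq : 0 ≤ ⟪A (y - c), y - c⟫_ℝ := le_trans (mul_nonneg hlam.le (sq_nonneg _)) (hcoer (y - c))
      have := hfloor y ⟨hy, hyB⟩
      have : F₀ ≤ F y := by nlinarith
      exact (min_le_left _ _).trans this
    · exact (min_le_right _ _).trans (hfar y ⟨hy, hyB⟩)
  -- integrability on `S` by domination with `e^{−β min(F₀,F₁)}·w`
  have hmeas : AEStronglyMeasurable (fun y => Real.exp (-(β * F y)) * w y) (volume.restrict S) :=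
    ((Real.measurable_exp.comp ((measurable_const.mul hFm).neg)).mul hwm).aestronglyMeasurable
  have hint : IntegrableOn (fun y => Real.exp (-(β * F y)) * w y) S := by
    refine Integrable.mono' (hwi.const_mul (Real.exp (-(β * min F₀ F₁)))) hmeas ?_
    refine (ae_restrict_iff' hS).2 (ae_of_all _ fun y hy => ?_)
    rw [Real.norm_eq_abs, abs_mul, abs_of_pos (Real.exp_pos _), abs_of_nonneg (hw0 y hy)]
    refine mul_le_mul_of_nonneg_right ?_ (hw0 y hy)
    exact Real.exp_le_exp.2 (by nlinarith [hFlow y hy])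
  refine ⟨hint, ?_⟩
  rw [← integral_inter_add_sdiff hB hint]
  -- the box: the centred Gaussian ceiling on `S ∩ B`
  have hbox := setIntegral_exp_neg_mul_le_gaussian_of_floor_centre hA hlam hcoer hδ1 hβ hW₀ (hS.inter hB) hFm hwm c hfloor
    (fun y hy => hw0 y hy.1) (fun y hy => hwW y hy.1)
  -- the tail: `e^{−βF} ≤ e^{−βF₁}` on `S \ B`, then enlarge the domain
  have htail : ∫ y in S \ B, Real.exp (-(β * F y)) * w y ≤ Real.exp (-(β * F₁)) * ∫ y in S, w y := by
    have h1 : ∫ y in S \ B, Real.exp (-(β * F y)) * w y ≤ ∫ y in S \ B, Real.exp (-(β * F₁)) * w y := by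
      refine setIntegral_mono_on (hint.mono_set sdiff_subset) ((hwi.mono_set sdiff_subset).const_mul _) (hS.diff hB) fun y hy => ?_
      exact mul_le_mul_of_nonneg_right (Real.exp_le_exp.2 (by nlinarith [hfar y hy])) (hw0 y hy.1)
    have h2 : ∫ y in S \ B, Real.exp (-(β * F₁)) * w y = Real.exp (-(β * F₁)) * ∫ y in S \ B, w y := integral_const_mul _ _
    have h3 : ∫ y in S \ B, w y ≤ ∫ y in S, w y :=
      setIntegral_mono_set hwi ((ae_restrict_iff' hS).2 (ae_of_all _ fun y hy => hw0 y hy)) (ae_of_all _ sdiff_subset)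
    rw [h2] at h1
    exact h1.trans (mul_le_mul_of_nonneg_left h3 (Real.exp_pos _).le)
  linarith

/-! ### (appended 2026-08-31, same seat) Integrating fibrewise ceilings over the base — the tip integral

`Z_tip = ∫_{T × S} e^{−bF̂} w ≤ ∫_T J_F(P̃) dν(P̃)` once every fibre integral is bounded by an integrable `g(P̃)` (the right-hand side of
✓`setIntegral_exp_neg_mul_le_gaussian_add_tail` at the base point `P̃`); integrability on the tube comes for free (Tonelli). -/

/-- ★★ **FIBREWISE CEILINGS INTEGRATE**: `F ≥ 0` measurable on `T × S`, every fibre integral `∫_S F(p,·) ≤ g p` (`p ∈ T`, fibre integrable), `g` integrable on `T`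
⟹ `F` is integrable on `T × S` and `∫_{T×S} F ≤ ∫_T g` (s-finite measures). [folklore] -/
theorem setIntegral_prod_le_of_fibre_ceiling {M W : Type*} [MeasurableSpace M] [MeasurableSpace W] {ν : Measure M} {κ : Measure W} [SFinite ν] [SFinite κ]
    {F : M × W → ℝ} (hFm : Measurable F) {T : Set M} {S : Set W} (hT : MeasurableSet T)
    (hF0 : ∀ p ∈ T, ∀ y ∈ S, 0 ≤ F (p, y)) {g : M → ℝ} (hgi : IntegrableOn g T ν)
    (hfib : ∀ p ∈ T, IntegrableOn (fun y => F (p, y)) S κ ∧ ∫ y in S, F (p, y) ∂κ ≤ g p) (hS : MeasurableSet S) :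
    IntegrableOn F (T ×ˢ S) (ν.prod κ) ∧ ∫ z in T ×ˢ S, F z ∂(ν.prod κ) ≤ ∫ p in T, g p ∂ν := by
  have hprod : (ν.prod κ).restrict (T ×ˢ S) = (ν.restrict T).prod (κ.restrict S) := (Measure.prod_restrict T S).symm
  -- fibrewise facts, almost everywhere in the base
  have hae_int : ∀ᵐ p ∂(ν.restrict T), Integrable (fun y => F (p, y)) (κ.restrict S) :=
    (ae_restrict_iff' hT).2 (ae_of_all _ fun p hp => (hfib p hp).1)
  have hnorm_eq : ∀ p ∈ T, ∫ y, ‖F (p, y)‖ ∂(κ.restrict S) = ∫ y in S, F (p, y) ∂κ := fun p hp =>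
    integral_congr_ae ((ae_restrict_iff' hS).2 (ae_of_all _ fun y hy => by
      show ‖F (p, y)‖ = F (p, y)
      rw [Real.norm_eq_abs, abs_of_nonneg (hF0 p hp y hy)]))
  have hnorm_meas : AEStronglyMeasurable (fun p => ∫ y, ‖F (p, y)‖ ∂(κ.restrict S)) (ν.restrict T) :=
    (hFm.norm.stronglyMeasurable.integral_prod_right' (ν := κ.restrict S)).aestronglyMeasurable
  have hnorm_int : Integrable (fun p => ∫ y, ‖F (p, y)‖ ∂(κ.restrict S)) (ν.restrict T) := by
    refine Integrable.mono' hgi hnorm_meas ((ae_restrict_iff' hT).2 (ae_of_all _ fun p hp => ?_))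
    rw [Real.norm_eq_abs, abs_of_nonneg (integral_nonneg fun y => norm_nonneg _), hnorm_eq p hp]
    exact (hfib p hp).2
  have hFint : Integrable F ((ν.restrict T).prod (κ.restrict S)) :=
    (integrable_prod_iff hFm.aestronglyMeasurable).2 ⟨hae_int, hnorm_int⟩
  refine ⟨by rw [IntegrableOn, hprod]; exact hFint, ?_⟩
  rw [hprod, integral_prod F hFint]
  refine integral_mono_ae hFint.integral_prod_left hgi ((ae_restrict_iff' hT).2 (ae_of_all _ fun p hp => ?_))
  exact (hfib p hp).2

end Summit.QuantumFields.YangMills.Theorems.QuantitativeLaplace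

end
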